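import Mathlib

/-!
# The translation lemma: invariants of `β ↦ β + ρ` on `A[β]` in characteristic `p` (V3U-A / V5 §B, stub B1)

(crux stmt-ResolutionOfSingularities-15640 `WildQuotients.WildQuotientResolution`, line `Sketch`,
sector `|G| = p`; programme V3U «toric exit» of `L/w45c/CHAIN.md` v5 §4 row stub-1, candidate B1
`fixedPoints_translate` of `L/w45c/W45cPlanSignaturesV5.lean` (planner res-L1-w45c-plan-1), signature
verbatim; [OURS · L1 W4.5c] — NOT a statement of any manuscript; replaces the role of no printed item.
Route-independent: `import Mathlib` only.)

For a commutative ring `A` of prime characteristic `p` and a non-zero-divisor `ρ ∈ A`, the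
`A`-algebra automorphism `τ : f(X) ↦ f(X + ρ)` of `A[X]` (`Polynomial.algEquivAevalXAddC ρ`, i.e.
`Polynomial.taylor ρ`) has fixed ring EXACTLY `A[N]`, `N = X^p − ρ^{p−1} X` (the Artin–Schreier
element): `τ f = f ↔ f ∈ (aeval N).range` (`fixedPoints_translate`).
* `⊇`: `τ N = N` because `(X + ρ)^p = X^p + ρ^p` (`taylor_artinSchreier`), and `τ (g ∘ N) = g ∘ τ N`.
* `⊆` (`mem_range_of_taylor_eq`, strong induction on the degree): divide `f = N q + r`,
  `deg r < p`, by the monic `N`; uniqueness of division and `τ N = N` give `τ q = q`, `τ r = r`;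
  a fixed `r` of degree `d < p` is constant, since the coefficient of `X^{d−1}` in `τ r` is
  `r_{d−1} + d ρ r_d` (`taylor_coeff` / `hasseDeriv_coeff`) and `d` is a unit, `ρ` a non-zero-divisor
  (`natDegree_eq_zero_of_taylor_eq`); `q` has smaller degree.
This is the algebraic heart of the root-chart computation of V3U (§C): on the root chart
`k[ρ, β, …]` of `Bl_{(x_a, x_b²)} 𝔸ⁿ` the Jordan block `J₃` acts by the translation `β ↦ β + ρ`.
-/

-- single-problem summit: the doubled namespace component `ResolutionOfSingularities` is forced
set_option linter.dupNamespace false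

noncomputable section

open Polynomial

namespace Summit.ResolutionOfSingularities.ResolutionOfSingularities.Theorems.WildQuotientResolution.ToricExit

variable {A : Type*} [CommRing A]

/-- `algEquivAevalXAddC ρ` is the Taylor shift `taylor ρ` (`f ↦ f(X + ρ)`). [folklore] -/
theorem algEquivAevalXAddC_eq_taylor (ρ : A) (f : A[X]) :
    algEquivAevalXAddC ρ f = taylor ρ f := by
  rw [algEquivAevalXAddC_apply, taylor_apply, comp_eq_aeval]

/-- **The Artin–Schreier element `N = X^p − ρ^{p−1} X` is translation invariant**:
`N(X + ρ) = N(X)` in characteristic `p` (`(X + ρ)^p = X^p + ρ^p`). [folklore: Artin–Schreier] -/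
theorem taylor_artinSchreier (p : ℕ) [Fact p.Prime] [CharP A p] (ρ : A) :
    taylor ρ (X ^ p - C (ρ ^ (p - 1)) * X : A[X]) = X ^ p - C (ρ ^ (p - 1)) * X := by
  have hp : p - 1 + 1 = p := Nat.succ_pred_eq_of_pos (Fact.out : p.Prime).pos
  rw [map_sub, taylor_pow, taylor_mul, taylor_C, taylor_X, add_pow_char, mul_add, ← map_pow,
    ← map_mul, ← pow_succ, hp]
  ring

/-- Elements of `A[N]` are translation invariant. [folklore] -/
theorem taylor_eq_self_of_mem_range (p : ℕ) [Fact p.Prime] [CharP A p] (ρ : A) (f : A[X])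
    (hf : f ∈ (aeval (R := A) (X ^ p - C (ρ ^ (p - 1)) * X : A[X])).range) :
    taylor ρ f = f := by
  obtain ⟨g, rfl⟩ := (AlgHom.mem_range _).mp hf
  rw [← comp_eq_aeval, taylor_apply, comp_assoc, ← taylor_apply, taylor_artinSchreier]

/-- In characteristic `p`, a natural number `d` with `0 < d < p` is a unit. [folklore] -/
theorem isUnit_natCast_of_lt (p : ℕ) [Fact p.Prime] [CharP A p] (d : ℕ) (hd0 : 0 < d)
    (hdp : d < p) : IsUnit (d : A) := by
  have hz : (d : ZMod p) ≠ 0 := by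
    rw [Ne, ZMod.natCast_eq_zero_iff]
    exact fun h => absurd (Nat.le_of_dvd hd0 h) (not_le.mpr hdp)
  have h := (isUnit_iff_ne_zero.mpr hz).map (ZMod.castHom (dvd_refl p) A)
  rwa [map_natCast] at h

/-- **A translation-invariant polynomial of degree `< p` is constant**: if `deg r = d` with
`1 ≤ d < p` then the coefficient of `X^{d−1}` in `r(X + ρ)` is `r_{d−1} + d ρ r_d`, so `d ρ r_d = 0`,
and `d` is a unit, `ρ` a non-zero-divisor. [folklore] -/
theorem natDegree_eq_zero_of_taylor_eq (p : ℕ) [Fact p.Prime] [CharP A p] (ρ : A)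
    (hρ : ρ ∈ nonZeroDivisors A) (r : A[X]) (hdeg : r.natDegree < p) (hr : taylor ρ r = r) :
    r.natDegree = 0 := by
  by_contra hd
  set d := r.natDegree with hd'
  have hd1 : 1 ≤ d := Nat.one_le_iff_ne_zero.mpr hd
  have hdd : d - 1 + 1 = d := Nat.sub_add_cancel hd1
  -- the coefficient of `X^{d-1}` in `r(X + ρ)`
  have hh : (hasseDeriv (d - 1) r).natDegree < 2 := by
    have h := natDegree_hasseDeriv_le r (d - 1)
    omega
  have key : (taylor ρ r).coeff (d - 1) = r.coeff (d - 1) + (d : A) * r.coeff d * ρ := by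
    have h1 : 1 + (d - 1) = d := by omega
    have hch : d.choose (d - 1) = d := by
      have h := Nat.choose_succ_self_right (d - 1)
      rwa [hdd] at h
    rw [taylor_coeff, eval_eq_sum_range' hh]
    simp only [Finset.sum_range_succ, Finset.sum_range_zero, zero_add, hasseDeriv_coeff,
      Nat.choose_self, Nat.cast_one, one_mul, pow_zero, mul_one, pow_one, h1, hch]
  rw [hr] at key
  have hzero : (d : A) * r.coeff d * ρ = 0 := by
    have := key
    linear_combination -this
  have h2 : (d : A) * r.coeff d = 0 := (mul_right_mem_nonZeroDivisors_eq_zero_iff hρ).mp hzero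
  have hu : IsUnit (d : A) := isUnit_natCast_of_lt p d hd1 hdeg
  have hlc : r.coeff d = 0 := (hu.mul_right_eq_zero).mp h2
  have hr0 : r = 0 := leadingCoeff_eq_zero.mp (by rw [leadingCoeff, ← hd']; exact hlc)
  exact hd (by rw [hd', hr0, natDegree_zero])

/-- **Translation-invariant polynomials lie in `A[N]`** (strong induction on the degree: divide by
the monic invariant `N`; quotient and remainder are invariant by uniqueness of division; the
remainder is constant, the quotient has smaller degree). [folklore: Artin–Schreier] -/
theorem mem_range_of_taylor_eq (p : ℕ) [Fact p.Prime] [CharP A p] (ρ : A)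
    (hρ : ρ ∈ nonZeroDivisors A) :
    ∀ (n : ℕ) (f : A[X]), f.natDegree ≤ n → taylor ρ f = f →
      f ∈ (aeval (R := A) (X ^ p - C (ρ ^ (p - 1)) * X : A[X])).range := by
  haveI : Nontrivial A := CharP.nontrivial_of_char_ne_one (Fact.out : p.Prime).ne_one
  set N : A[X] := X ^ p - C (ρ ^ (p - 1)) * X with hN
  have hp2 : 2 ≤ p := (Fact.out : p.Prime).two_le
  have hdegCX : (C (ρ ^ (p - 1)) * X : A[X]).degree < (X ^ p : A[X]).degree := by
    rw [degree_X_pow]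
    refine (degree_C_mul_X_le _).trans_lt ?_
    exact_mod_cast (show (1 : ℕ) < p by omega)
  have hNmonic : N.Monic := (monic_X_pow p).sub_of_left hdegCX
  have hlt : (C (ρ ^ (p - 1)) * X : A[X]).natDegree < (X ^ p : A[X]).natDegree := by
    rw [natDegree_X_pow]
    exact lt_of_le_of_lt ((natDegree_C_mul_le _ _).trans natDegree_X_le) (by omega)
  have hNdeg : N.natDegree = p := by
    rw [hN, natDegree_sub_eq_left_of_natDegree_lt hlt, natDegree_X_pow]
  have hNτ : taylor ρ N = N := taylor_artinSchreier p ρ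
  have hNmem : N ∈ (aeval (R := A) N).range := (AlgHom.mem_range _).mpr ⟨X, aeval_X N⟩
  have hCmem : ∀ c : A, C c ∈ (aeval (R := A) N).range := fun c =>
    (AlgHom.mem_range _).mpr ⟨C c, aeval_C N c⟩
  intro n
  induction n using Nat.strong_induction_on with
  | _ n ih =>
    intro f hfn hf
    -- division by `N`
    have hdiv : f %ₘ N + N * (f /ₘ N) = f := modByMonic_add_div f N
    have hrdeg : (f %ₘ N).degree < N.degree := degree_modByMonic_lt f hNmonic
    have huniq : f /ₘ N = taylor ρ (f /ₘ N) ∧ f %ₘ N = taylor ρ (f %ₘ N) := by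
      refine div_modByMonic_unique (taylor ρ (f /ₘ N)) (taylor ρ (f %ₘ N)) hNmonic ⟨?_, ?_⟩
      · have h := congrArg (taylor ρ) hdiv
        rw [map_add, taylor_mul, hNτ, hf] at h
        exact h
      · rwa [degree_taylor]
    have hτq : taylor ρ (f /ₘ N) = f /ₘ N := huniq.1.symm
    have hτr : taylor ρ (f %ₘ N) = f %ₘ N := huniq.2.symm
    -- the remainder is constant
    have hrmem : f %ₘ N ∈ (aeval (R := A) N).range := by
      by_cases hr0 : f %ₘ N = 0
      · rw [hr0]; exact Subalgebra.zero_mem _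
      · have hrnat : (f %ₘ N).natDegree < p := by
          rw [← hNdeg]
          exact natDegree_lt_natDegree hr0 hrdeg
        have h0 := natDegree_eq_zero_of_taylor_eq p ρ hρ _ hrnat hτr
        rw [eq_C_of_natDegree_eq_zero h0]
        exact hCmem _
    -- the quotient has smaller degree (or vanishes)
    have hqmem : f /ₘ N ∈ (aeval (R := A) N).range := by
      by_cases hfp : f.degree < N.degree
      · rw [(divByMonic_eq_zero_iff hNmonic).mpr hfp]
        exact Subalgebra.zero_mem _
      · have hfN : p ≤ f.natDegree := by
          rw [← hNdeg]
          rw [not_lt] at hfp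
          exact natDegree_le_natDegree hfp
        have hqdeg : (f /ₘ N).natDegree < n := by
          rw [natDegree_divByMonic f hNmonic, hNdeg]
          omega
        exact ih _ hqdeg (f /ₘ N) le_rfl hτq
    rw [← hdiv]
    exact Subalgebra.add_mem _ hrmem (Subalgebra.mul_mem _ hNmem hqmem)

/-- **B1 `fixedPoints_translate` (V3U-A; `W45cPlanSignaturesV5.lean` §B, signature verbatim):**
over a commutative ring `A` of prime characteristic `p`, for a non-zero-divisor `ρ`, the fixed
points of the `A`-algebra automorphism `X ↦ X + ρ` of `A[X]` are exactly `A[N]`,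
`N = X^p − ρ^{p−1} X`. [OURS · L1 W4.5c] [folklore: Artin–Schreier] -/
theorem fixedPoints_translate (p : ℕ) [Fact p.Prime] (A : Type) [CommRing A] [CharP A p]
    (ρ : A) (hρ : ρ ∈ nonZeroDivisors A) (f : Polynomial A) :
    Polynomial.algEquivAevalXAddC ρ f = f ↔
      f ∈ (Polynomial.aeval (R := A)
        (Polynomial.X ^ p - Polynomial.C (ρ ^ (p - 1)) * Polynomial.X : Polynomial A)).range := by
  rw [algEquivAevalXAddC_eq_taylor]
  exact ⟨fun h => mem_range_of_taylor_eq p ρ hρ f.natDegree f le_rfl h,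
    fun h => taylor_eq_self_of_mem_range p ρ f h⟩

end Summit.ResolutionOfSingularities.ResolutionOfSingularities.Theorems.WildQuotientResolution.ToricExit

end
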